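import Mathlib
import HarnessLib
import Summits.NavierStokesRegularity.NavierStokesRegularity.Theorems.PoloidalWindowDoorPoloidalWindowRigidityNearOneFloor

/-!
# Route `PoloidalWindowDoor`, crux `PoloidalWindowRigidity` (K2, stmt-NavierStokesRegularity-19708) — THICK column, LINE 28 «near_one» (ns-idea-8) §28, PORTED:
# THE SCALING SYMMETRY GROUP OF A PINNED PROFILE ABOUT ANY CENTRE is TRIVIAL or CYCLIC with least factor `≥ λ_*(C, B)`

Seat ns-poloidal-K2-p2 g15 (DIRECTOR-NS #306, idea-crit-7's errand R2; `--supports stmt-NavierStokesRegularity-19708 --as helper`).  Source: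
`Cruxes/PoloidalWindowRigidity/Lines/near_identity.lean` 63c9d39e624d §28 (= `near_one.lean` §28) VERBATIM, except: `Pinned C v` UNFOLDED VERBATIM, `hAG : AnisotropicGap`
DISCHARGED (landed U3a via `…NearOneFloor.nearOne_pinned`), objects from `…NearIdentityDefs`.

* `scalingGroup_trichotomy` — for every `C`, `B` there is `λ_* > 1` such that for every pinned class-`C` profile `v` and centre `‖c‖ ≤ B`: either `v` has NO
  non-trivial DSS factor about `c`, or its factors about `c` are exactly the integer powers of a least factor `a₀ ≥ λ_*` (closedness of the factor set
  `isDss_of_tendsto` + the near-one floor `nearOne_pinned` + Archimedean bookkeeping with `⌊log a / log a₀⌋`).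

WHAT THIS IS NOT: not a claim about Navier–Stokes regularity — a ported support of a files-only line (bears_on LADDER-NS N0, rung N0-LocalTubeDoorPoloidal); LINE 28/29's
research cells, crux 19708 / item 20428, ⟨27893⟩ OPEN; NS regularity NOT proved.
-/

noncomputable section

-- the summit and its single sub-problem share the name (CONVENTIONS §1), as in every Theorems file
set_option linter.dupNamespace false

namespace Summit.NavierStokesRegularity.NavierStokesRegularity.Theorems.PoloidalWindowDoorPoloidalWindowRigidityNearOneScalingGroup

open Set Function Filter Topology Metric
open scoped InnerProductSpace RealInnerProductSpace Laplacian NNReal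
open Literature.Analysis Literature.Analysis.FluidPDE Literature.Analysis.UnboundedOperators
open Summit.NavierStokesRegularity.NavierStokesRegularity.Theorems
open PoloidalWindowDoorPoloidalWindowRigidityNearIdentityDefs PoloidalWindowDoorPoloidalWindowRigidityNearOneFloor

/-! ## §28 THE SCALING SYMMETRY GROUP OF A PINNED PROFILE ABOUT ANY CENTRE (PROVED): trivial, or cyclic with least factor `≥ λ_*(C, B)` -/

/-- **Structure theorem (PROVED).** For every `C` and `B` there is `λ_* > 1` such that, for every pinned class-`C` profile `v` and every centre `‖c‖ ≤` … (abridged; full docstring in `Lines/near_one.lean`) -/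
theorem scalingGroup_trichotomy (C B : ℝ) :
    ∃ lamStar : ℝ, 1 < lamStar ∧ ∀ (v : ℝ → EuclideanSpace ℝ (Fin 3) → EuclideanSpace ℝ (Fin 3)) (c : EuclideanSpace ℝ (Fin 3)), (Literature.Analysis.FluidPDE.HasTypeITimeDecay C v ∧
        ContinuousOn (Function.uncurry v) (Set.Iio (0 : ℝ) ×ˢ Set.univ) ∧
        (∀ s t : ℝ, s < t → t < 0 → ∀ x, v t x =
          Literature.Analysis.UnboundedOperators.heatExtension (v s) (t - s) x -
            Literature.Analysis.FluidPDE.oseenDuhamel 1 s v v t x) ∧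
        (∀ t < 0, Literature.Analysis.FluidPDE.VectorCalculus.IsDivFree (v t)) ∧
        (∀ s < 0, ∀ q, ⟪Literature.Analysis.FluidPDE.curl (v s) q, EuclideanSpace.single 2 1⟫_ℝ = 0) ∧
        v (-1) 0 2 ≠ 0 ∧ (∀ t < 0, ∀ x, Real.sqrt (-t) * |v t x 2| ≤ |v (-1) 0 2|) ∧
        (∀ h : EuclideanSpace ℝ (Fin 3), fderiv ℝ (v (-1)) 0 h 2 = 0) ∧
        (deriv (fun s => v s 0 2) (-1) = v (-1) 0 2 / 2 ∧ v (-1) 0 2 * (Δ (fun q => v (-1) q 2)) 0 ≤ 0)) → ‖c‖ ≤ B →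
      (∀ a : ℝ, 0 < a → IsDssAbout c a v → a = 1) ∨
      (∃ a₀ : ℝ, lamStar ≤ a₀ ∧ IsDssAbout c a₀ v ∧ ∀ a : ℝ, 0 < a → IsDssAbout c a v → ∃ k : ℤ, a = a₀ ^ k) := by
  obtain ⟨lamStar, h1, H⟩ := nearOne_pinned C B
  refine ⟨lamStar, h1, fun v c hP hcB => ?_⟩
  set w : ℝ → EuclideanSpace ℝ (Fin 3) → EuclideanSpace ℝ (Fin 3) := fun t x => v t (x + c) with hwdef
  have hw : IsTypeIAncientMild C w := (PoloidalWindowDoorPoloidalWindowRigidityWindow.isTypeIAncientMild_of_class hP.1 hP.2.1 hP.2.2.1 hP.2.2.2.1).comp_add_right c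
  have hiff : ∀ a : ℝ, IsDssAbout c a v ↔ IsDss a w := fun a => isDssAbout_iff_translate
  have hno : ∀ a : ℝ, 1 < a → IsDss a w → lamStar ≤ a := by
    intro a ha hd
    by_contra hlt
    exact H v a c hP hcB ha (not_le.1 hlt) ((hiff a).2 hd)
  set P : Set ℝ := {a | 1 < a ∧ IsDss a w} with hPdef
  by_cases hPe : P = ∅
  · left
    intro a ha hd
    rw [hiff] at hd
    by_contra hne
    rcases lt_or_gt_of_ne hne with hlt | hgt
    · have hinv : 1 < a⁻¹ := (one_lt_inv₀ ha).2 hlt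
      have : a⁻¹ ∈ P := ⟨hinv, hd.inv ha⟩
      rw [hPe] at this
      exact this
    · have : a ∈ P := ⟨hgt, hd⟩
      rw [hPe] at this
      exact this
  · right
    have hPne : P.Nonempty := Set.nonempty_iff_ne_empty.2 hPe
    have hPbdd : BddBelow P := ⟨lamStar, fun a ha => hno a ha.1 ha.2⟩
    set a₀ : ℝ := sInf P with ha₀
    have ha₀ge : lamStar ≤ a₀ := le_csInf hPne fun a ha => hno a ha.1 ha.2
    have ha₀1 : 1 < a₀ := h1.trans_le ha₀ge
    have ha₀0 : 0 < a₀ := by linarith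
    have ha₀P : IsDss a₀ w := by
      have hmem : a₀ ∈ closure P := csInf_mem_closure hPne hPbdd
      obtain ⟨u, huP, hulim⟩ := mem_closure_iff_seq_limit.1 hmem
      exact isDss_of_tendsto hw.1.continuousOn ha₀0 hulim fun n => (huP n).2
    refine ⟨a₀, ha₀ge, (hiff a₀).2 ha₀P, fun a ha hd => ?_⟩
    rw [hiff] at hd
    set L : ℝ := Real.log a₀ with hL
    have hL0 : 0 < L := Real.log_pos ha₀1
    set k : ℤ := ⌊Real.log a / L⌋ with hk
    have hk1 : (k : ℝ) ≤ Real.log a / L := Int.floor_le _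
    have hk2 : Real.log a / L < (k : ℝ) + 1 := Int.lt_floor_add_one _
    have hpowk : 0 < a₀ ^ k := zpow_pos ha₀0 k
    have hlogpow : Real.log (a₀ ^ k) = (k : ℝ) * L := by rw [Real.log_zpow]
    have hle : a₀ ^ k ≤ a := by
      rw [← Real.log_le_log_iff hpowk ha, hlogpow]
      have := (le_div_iff₀ hL0).1 hk1
      linarith
    have hlt' : a < a₀ ^ (k + 1) := by
      rw [← Real.log_lt_log_iff ha (zpow_pos ha₀0 _), Real.log_zpow]
      have := (div_lt_iff₀ hL0).1 hk2
      push_cast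
      linarith
    set r : ℝ := a * (a₀ ^ k)⁻¹ with hr
    have hrd : IsDss r w := hd.mul ha ((ha₀P.zpow ha₀0 k).inv hpowk)
    have hr1 : 1 ≤ r := by
      rw [hr, le_mul_inv_iff₀ hpowk, one_mul]
      exact hle
    have hra₀ : r < a₀ := by
      rw [hr, mul_inv_lt_iff₀ hpowk, mul_comm, ← zpow_add_one₀ ha₀0.ne']
      exact hlt'
    rcases hr1.eq_or_lt with heq | hgt1
    · refine ⟨k, ?_⟩
      have : a * (a₀ ^ k)⁻¹ = 1 := heq.symm
      rwa [mul_inv_eq_one₀ hpowk.ne'] at this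
    · exfalso
      have hrP : r ∈ P := ⟨hgt1, hrd⟩
      have : a₀ ≤ r := csInf_le hPbdd hrP
      linarith


end Summit.NavierStokesRegularity.NavierStokesRegularity.Theorems.PoloidalWindowDoorPoloidalWindowRigidityNearOneScalingGroup

end
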